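import Summits.NavierStokesRegularity.FluidComputer.PalasekTowerBurgersNumberLevelZeroSharp

/-!
# REGISTER v2.3′: the Burgers number AT LEVEL 1 → 2, certified constants (the window of item 19249)

The `k = 1` sheet of `PalasekTowerBurgersNumberLevelZero(Sharp).lean` (p445941 / p447797; cell
`ns-blowup`, seat `ns-blowup-ecbridge-8` (g4)): evidence toward `stmt-NavierStokesRegularity-19249`
(`HeredityAtOne`, readout half `ReadoutFloorsAt 1`: the level-2 child must be read in the window
`[τ₁, τ₂]`) and 19250. LABEL: MODEL-side register arithmetic — the `k = 1` instances of the general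
theorems of `PalasekTowerBurgersNumber(Strain).lean` with the Burgers factor `N₁^{1/20} = 2^{11/25}`,
the DC1 margin `N₁^{1/10} = 2^{22/25}` and the amplitude jump `A₂/A₁` replaced by certified brackets.
MODEL identification: «the level-2 child core is the Burgers vortex of circulation
`C · N₂^{β−2} = 7.48·C` at `ν = 1` in the host strain `λ · A₁`»; `P := C√λ · N₁^{1/20}`.

WHAT THIS IS NOT: not NS — nothing about registered flows, `ReadoutFloorsAt 1`, `AprioriCeilingAt 1`
or the truth of 19249.

## The numbers (wide rates, `Schedule.Rigid`, `ν = 1`)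

`1.3566 < N₁^{1/20} < 1.3567`, `1.8403 < N₁^{1/10} < 1.8404`, `4.067A₁ < A₂ < 4.0672A₁`
(`7.484 < N₂^{β−2} < 7.485` from the calibration file). Thresholds on `C√λ`: `≤ 21.37` ⇒ no overshoot
of `c₂Y₂`; `≥ 25.07` ⇒ overshoot; `≥ 14.75` ⇒ velocity floor `c₁Y₂` ON the core; `≤ 12.53` ⇒ missed.
Necessary band: **`13.09 < C√λ < 24.43`**. Strain floor `c₁A₂` on the axis from **`Cλ ≥ 13.66`**
(`8π/N₁^{1/10} = 13.656`); missed everywhere (sharp form) if `λ(1 + 0.2979·C) ≤ 4.067`. λ-floors: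
AXIS READING **`λ > 0.31`** (`C < 43.8`); FULL-FIELD READING **`λ > 0.27`**. (Level `0 → 1` for
comparison: band `[13.46, 25.12]`, `Cλ ≥ 14.44`, `λ > 0.33 / 0.28`.)

References: P. G. Saffman, *Vortex Dynamics*, CUP 1992, §13.1 (4), §13.3 (9), (12)
[cite: Saffman1992, §13.3 eq. (12)]; S. Palasek, arXiv:2605.13827, §3 (3.2)
[cite: Palasek2026ElementaryModel, §3 (3.2)].
-/

namespace Summit.NavierStokesRegularity.FluidComputer.PalasekTowerClayBridge

open Real
open Literature.Analysis.FluidPDE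

/-! ## §1 Certified level-1 constants -/

/-- `N₁^q = 2^{(44/5)q}` on the wide rates (`N₁ = 256^{11/10} = 2^{44/5}`). -/
theorem wide_N_one_rpow_eq (q : ℝ) : TowerRates.wide.N 1 ^ q = (2 : ℝ) ^ (44 / 5 * q) := by
  have h : TowerRates.wide.N 1 = (2 : ℝ) ^ (44 / 5 : ℝ) := by
    show (256 : ℝ) ^ ((11 / 10 : ℝ) ^ 1) = _
    rw [pow_one, show (256 : ℝ) = (2 : ℝ) ^ (8 : ℝ) by norm_num, ← Real.rpow_mul (by norm_num)]
    norm_num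
  rw [h, ← Real.rpow_mul (by norm_num)]

/-- **The level-1 Burgers factor** `N₁^{1/20} = 2^{11/25} ∈ (1.3566, 1.3567)`. -/
theorem wide_burgersFactor_one_bounds :
    1.3566 < TowerRates.wide.N 1 ^ (1 / 20 : ℝ) ∧ TowerRates.wide.N 1 ^ (1 / 20 : ℝ) < 1.3567 := by
  rw [wide_N_one_rpow_eq, show (44 : ℝ) / 5 * (1 / 20) = 11 / 25 by norm_num]
  exact ⟨TowerRates.lt_two_rpow_of_pow_lt (a := 11) (m := 1) (r := 25) (by norm_num) (by norm_num),
    TowerRates.two_rpow_lt_of_pow_lt (by norm_num) (a := 11) (m := 1) (r := 25) (by norm_num)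
      (by norm_num)⟩

/-- **The level-1 DC1 margin** `N₁^{1/10} = 2^{22/25} ∈ (1.8403, 1.8404)`. -/
theorem wide_dc1Margin_one_bounds :
    1.8403 < TowerRates.wide.N 1 ^ (1 / 10 : ℝ) ∧ TowerRates.wide.N 1 ^ (1 / 10 : ℝ) < 1.8404 := by
  rw [wide_N_one_rpow_eq, show (44 : ℝ) / 5 * (1 / 10) = 22 / 25 by norm_num]
  exact ⟨TowerRates.lt_two_rpow_of_pow_lt (a := 22) (m := 1) (r := 25) (by norm_num) (by norm_num),
    TowerRates.two_rpow_lt_of_pow_lt (by norm_num) (a := 22) (m := 1) (r := 25) (by norm_num)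
      (by norm_num)⟩

/-- **The amplitude jump** `A₂/A₁ ∈ (4.067, 4.0672)` (certified integer brackets of `A₁`, `A₂`). -/
theorem wide_A_two_div_A_one_bounds :
    4.067 * TowerRates.wide.A 1 < TowerRates.wide.A 2 ∧
      TowerRates.wide.A 2 < 4.0672 * TowerRates.wide.A 1 := by
  obtain ⟨h1, h1'⟩ := TowerRates.wide_A_one_bounds
  obtain ⟨h2, h2'⟩ := TowerRates.wide_A_two_bounds
  constructor <;> linarith

/-! ## §2 The polytope at level `1 → 2` -/

/-- Upper transfer: `C√λ ≤ M` and `M · 1.3567 ≤ B` give `P ≤ B`. -/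
private theorem burgersNumber_one_le {C l M B : ℝ} (hC : 0 ≤ C) (h : C * Real.sqrt l ≤ M)
    (hB : M * 1.3567 ≤ B) : C * Real.sqrt l * TowerRates.wide.N 1 ^ (1 / 20 : ℝ) ≤ B := by
  obtain ⟨-, hf⟩ := wide_burgersFactor_one_bounds
  have hP : 0 ≤ C * Real.sqrt l := mul_nonneg hC (Real.sqrt_nonneg _)
  have hf0 : 0 ≤ TowerRates.wide.N 1 ^ (1 / 20 : ℝ) := Real.rpow_nonneg (TowerRates.wide.N_pos 1).le _
  nlinarith [mul_le_mul h hf.le hf0 (hP.trans h)]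

/-- Lower transfer: `M ≤ C√λ`, `0 ≤ M` and `B ≤ M · 1.3566` give `B ≤ P`. -/
private theorem le_burgersNumber_one {C l M B : ℝ} (h : M ≤ C * Real.sqrt l) (hM : 0 ≤ M)
    (hB : B ≤ M * 1.3566) : B ≤ C * Real.sqrt l * TowerRates.wide.N 1 ^ (1 / 20 : ℝ) := by
  obtain ⟨hf, -⟩ := wide_burgersFactor_one_bounds
  nlinarith [mul_le_mul h hf.le (by norm_num) (hM.trans h)]

/-- `17.7713 < 4√2π`, `(500π/79)·(5/3) < 33.1392`, `25.13273 < 8π < 25.13275`. -/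
private theorem burgers_constants_one :
    (17.7713 : ℝ) < 4 * Real.sqrt 2 * π ∧ 500 * π / 79 * (5 / 3 : ℝ) < 33.1392 ∧
      (25.13273 : ℝ) < 8 * π ∧ 8 * π < (25.13275 : ℝ) := by
  have hpi1 := Real.pi_gt_d6
  have hpi2 := Real.pi_lt_d6
  have hs : (1.41421 : ℝ) < Real.sqrt 2 := by
    rw [Real.lt_sqrt (by norm_num)]; norm_num
  refine ⟨by nlinarith, by nlinarith, by linarith, by linarith⟩

/-- **Certified thresholds at level `1 → 2`** (wide rates, `Schedule.Rigid`): `C√λ ≤ 21.37` ⇒ no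
overshoot of `S.c₂ · Y₂` anywhere; `C√λ ≥ 25.07` ⇒ overshoot somewhere; `C√λ ≥ 14.75` ⇒ the velocity
floor `S.c₁ · Y₂` is met ON the core; `C√λ ≤ 12.53` ⇒ it is missed everywhere. -/
theorem palasekTowerBreakdown_burgers_thresholds_one (S : Schedule TowerRates.wide) (hS : S.Rigid)
    {C l : ℝ} (hC : 0 ≤ C) (hl : 0 < l) :
    (C * Real.sqrt l ≤ 21.37 → ∀ x : EuclideanSpace ℝ (Fin 3),
      ‖burgersVortexSwirl (l * TowerRates.wide.A 1) 1
          (C * TowerRates.wide.N 2 ^ (TowerRates.wide.β - 2)) x‖ ≤ S.c₂ * TowerRates.wide.Y 2) ∧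
    (25.07 ≤ C * Real.sqrt l → ∃ x : EuclideanSpace ℝ (Fin 3),
      S.c₂ * TowerRates.wide.Y 2 < ‖burgersVortexSwirl (l * TowerRates.wide.A 1) 1
          (C * TowerRates.wide.N 2 ^ (TowerRates.wide.β - 2)) x‖) ∧
    (14.75 ≤ C * Real.sqrt l → ∃ x : EuclideanSpace ℝ (Fin 3),
      S.c₁ * TowerRates.wide.Y 2 ≤ ‖burgersVortexSwirl (l * TowerRates.wide.A 1) 1
          (C * TowerRates.wide.N 2 ^ (TowerRates.wide.β - 2)) x‖) ∧
    (C * Real.sqrt l ≤ 12.53 → ∀ x : EuclideanSpace ℝ (Fin 3),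
      ‖burgersVortexSwirl (l * TowerRates.wide.A 1) 1
          (C * TowerRates.wide.N 2 ^ (TowerRates.wide.β - 2)) x‖ < S.c₁ * TowerRates.wide.Y 2) := by
  obtain ⟨h29, h34, h20, h17⟩ := palasekTowerBreakdown_burgers_thresholds_rigid S hS 1 hC hl
  refine ⟨fun h => h29 ?_, fun h => h34 ?_, fun h => h20 ?_, fun h => h17 ?_⟩
  · exact burgersNumber_one_le hC h (by norm_num)
  · exact le_burgersNumber_one h (by norm_num) (by norm_num)
  · exact le_burgersNumber_one h (by norm_num) (by norm_num)
  · exact burgersNumber_one_le hC h (by norm_num)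

/-- **The necessary band at level `1 → 2`, certified**: velocity floor `S.c₁ · Y₂` met on the core AND
no overshoot of `S.c₂ · Y₂` ⇒ `13.09 < C√λ < 24.43`. -/
theorem palasekTowerBreakdown_burgers_band_one (S : Schedule TowerRates.wide) (hS : S.Rigid)
    {C l : ℝ} (hC : 0 ≤ C) (hl : 0 < l)
    (hfloor : ∃ x : EuclideanSpace ℝ (Fin 3), S.c₁ * TowerRates.wide.Y 2 ≤
      ‖burgersVortexSwirl (l * TowerRates.wide.A 1) 1
          (C * TowerRates.wide.N 2 ^ (TowerRates.wide.β - 2)) x‖)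
    (hceil : ∀ x : EuclideanSpace ℝ (Fin 3),
      ‖burgersVortexSwirl (l * TowerRates.wide.A 1) 1
          (C * TowerRates.wide.N 2 ^ (TowerRates.wide.β - 2)) x‖ ≤ S.c₂ * TowerRates.wide.Y 2) :
    13.09 < C * Real.sqrt l ∧ C * Real.sqrt l < 24.43 := by
  obtain ⟨h1, h2⟩ := palasekTowerBreakdown_burgers_band TowerRates.wide 1 hC hl hfloor hceil
  rw [palasekTowerBreakdown_burgers_exponent_wide, hS.c₁_eq] at h1
  rw [palasekTowerBreakdown_burgers_exponent_wide, hS.c₂_eq] at h2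
  obtain ⟨c17, c33, -, -⟩ := burgers_constants_one
  obtain ⟨hf, hf'⟩ := wide_burgersFactor_one_bounds
  have hP : 0 ≤ C * Real.sqrt l := mul_nonneg hC (Real.sqrt_nonneg _)
  constructor
  · by_contra h
    push Not at h
    have := mul_le_mul h hf'.le (Real.rpow_nonneg (TowerRates.wide.N_pos 1).le _) (by norm_num)
    nlinarith
  · by_contra h
    push Not at h
    have := mul_le_mul h hf.le (by norm_num) hP
    nlinarith

/-- **The strain floor at level `1 → 2` is met ON THE AXIS of the child core as soon as `Cλ ≥ 13.66`**
(`8π/N₁^{1/10} = 13.656`). -/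
theorem palasekTowerBreakdown_burgers_strainFloor_axis_one (S : Schedule TowerRates.wide)
    (hS : S.Rigid) {C l : ℝ} (hC : 0 ≤ C) (hl : 0 < l) (hP : 13.66 ≤ C * l) :
    ∃ x : EuclideanSpace ℝ (Fin 3), S.c₁ * TowerRates.wide.A 2 ≤
      ‖fderiv ℝ (burgersVortex (l * TowerRates.wide.A 1) 1
        (C * TowerRates.wide.N 2 ^ (TowerRates.wide.β - 2))) x‖ := by
  refine palasekTowerBreakdown_burgers_strainFloor_axis TowerRates.wide 1 hC hl ?_
  rw [palasekTowerBreakdown_burgers_strainExponent_wide, hS.c₁_eq]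
  obtain ⟨-, -, -, c8⟩ := burgers_constants_one
  obtain ⟨hg, -⟩ := wide_dc1Margin_one_bounds
  have hCl : 0 ≤ C * l := mul_nonneg hC hl.le
  nlinarith [mul_le_mul hP hg.le (by norm_num) hCl]

/-- **Sharp form at level `1 → 2`**: the strain floor `S.c₁ · A₂` is missed everywhere on the full
Burgers field when `λ(1 + 0.2979·C) ≤ 4.067` (`N₂^{β−2}/(8π) < 7.485/25.1327 < 0.2979`, `4.067A₁ < A₂`). -/
theorem palasekTowerBreakdown_burgers_strainFloor_missed_one_sharp (S : Schedule TowerRates.wide)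
    (hS : S.Rigid) {C l : ℝ} (hC : 0 ≤ C) (hl : 0 < l) (hP : l * (1 + 0.2979 * C) ≤ 4.067)
    (x : EuclideanSpace ℝ (Fin 3)) :
    ‖fderiv ℝ (burgersVortex (l * TowerRates.wide.A 1) 1
        (C * TowerRates.wide.N 2 ^ (TowerRates.wide.β - 2))) x‖ < S.c₁ * TowerRates.wide.A 2 := by
  refine palasekTowerBreakdown_burgers_strainFloor_missed_sharp TowerRates.wide 1 hC hl ?_ x
  rw [hS.c₁_eq, one_mul]
  obtain ⟨-, -, c8, -⟩ := burgers_constants_one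
  obtain ⟨-, hN⟩ := TowerRates.wide_N_two_rpow_bounds
  obtain ⟨hA, -⟩ := wide_A_two_div_A_one_bounds
  have hA1 : 0 < TowerRates.wide.A 1 := TowerRates.wide.A_pos 1
  have hN0 : 0 ≤ TowerRates.wide.N 2 ^ (TowerRates.wide.β - 2) :=
    Real.rpow_nonneg (TowerRates.wide.N_pos 2).le _
  have hq : (C * TowerRates.wide.N 2 ^ (TowerRates.wide.β - 2)) / (8 * π) ≤ 0.2979 * C := by
    rw [div_le_iff₀ (by positivity)]
    nlinarith [mul_le_mul_of_nonneg_left hN.le hC]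
  calc l * TowerRates.wide.A 1 * (1 + (C * TowerRates.wide.N 2 ^ (TowerRates.wide.β - 2)) / (8 * π))
      ≤ l * TowerRates.wide.A 1 * (1 + 0.2979 * C) := by
        refine mul_le_mul_of_nonneg_left (by linarith) (by positivity)
    _ = l * (1 + 0.2979 * C) * TowerRates.wide.A 1 := by ring
    _ ≤ 4.067 * TowerRates.wide.A 1 := mul_le_mul_of_nonneg_right hP hA1.le
    _ < TowerRates.wide.A 2 := hA

/-! ## §3 The λ-floors at level `1 → 2` -/

/-- **No overshoot caps the Burgers number at level 1**: `C√λ < 24.43`. -/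
theorem palasekTowerBreakdown_burgers_ceiling_cap_one (S : Schedule TowerRates.wide) (hS : S.Rigid)
    {C l : ℝ} (hC : 0 ≤ C) (hl : 0 < l)
    (hceil : ∀ x : EuclideanSpace ℝ (Fin 3),
      ‖burgersVortexSwirl (l * TowerRates.wide.A 1) 1
          (C * TowerRates.wide.N 2 ^ (TowerRates.wide.β - 2)) x‖ ≤ S.c₂ * TowerRates.wide.Y 2) :
    C * Real.sqrt l < 24.43 := by
  have h2 : C * Real.sqrt l * TowerRates.wide.N 1 ^ (TowerRates.wide.β / 2 - TowerRates.wide.b) ≤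
      500 * π / 79 * S.c₂ := by
    by_contra h
    push Not at h
    obtain ⟨x, hx⟩ := palasekTowerBreakdown_burgers_overshoot TowerRates.wide 1 hC hl h
    exact absurd (hceil x) (not_le.2 hx)
  rw [palasekTowerBreakdown_burgers_exponent_wide, hS.c₂_eq] at h2
  obtain ⟨-, c33, -, -⟩ := burgers_constants_one
  obtain ⟨hf, -⟩ := wide_burgersFactor_one_bounds
  have hP : 0 ≤ C * Real.sqrt l := mul_nonneg hC (Real.sqrt_nonneg _)
  by_contra h
  push Not at h
  have := mul_le_mul h hf.le (by norm_num) hP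
  nlinarith

/-- **The strain floor read on the child's own gradient at the axis pins `Cλ > 13.656`** (level 1). -/
theorem palasekTowerBreakdown_burgers_axisFloor_pins_one (S : Schedule TowerRates.wide)
    (hS : S.Rigid) {C l : ℝ} (hC : 0 ≤ C) (hl : 0 < l) {x₀ : EuclideanSpace ℝ (Fin 3)}
    (hx0 : x₀ 0 = 0) (hx1 : x₀ 1 = 0)
    (haxis : S.c₁ * TowerRates.wide.A 2 ≤
      ‖fderiv ℝ (burgersVortexSwirl (l * TowerRates.wide.A 1) 1
        (C * TowerRates.wide.N 2 ^ (TowerRates.wide.β - 2))) x₀‖) :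
    13.656 < C * l := by
  rw [norm_fderiv_burgersVortexSwirl_axis _ _ _ hx0 hx1,
    palasekTowerBreakdown_burgers_coreRate TowerRates.wide 1 hC hl,
    palasekTowerBreakdown_burgers_strainExponent_wide, hS.c₁_eq, one_mul] at haxis
  have hA2 : 0 < TowerRates.wide.A 2 := TowerRates.wide.A_pos 2
  have h1 : 1 ≤ C * l / (8 * π) * TowerRates.wide.N 1 ^ (1 / 10 : ℝ) := by
    by_contra h
    push Not at h
    have := mul_lt_mul_of_pos_right h hA2
    linarith
  obtain ⟨-, -, c8, -⟩ := burgers_constants_one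
  obtain ⟨-, hg⟩ := wide_dc1Margin_one_bounds
  have hpi : 0 < 8 * π := by positivity
  rw [div_mul_eq_mul_div, le_div_iff₀ hpi, one_mul] at h1
  have hCl : 0 ≤ C * l := mul_nonneg hC hl.le
  by_contra h
  push Not at h
  have := mul_le_mul h hg.le (Real.rpow_nonneg (TowerRates.wide.N_pos 1).le _) (by norm_num)
  nlinarith

/-- **λ-floor at level `1 → 2`, AXIS READING**: no overshoot of `S.c₂ · Y₂` anywhere and the child's
own gradient meets `S.c₁ · A₂` at an axis point ⇒ `13.65 < Cλ`, `C√λ < 24.43`, **`0.31 < λ`**,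
`C < 43.8`. -/
theorem palasekTowerBreakdown_burgers_lambda_floor_axis_one (S : Schedule TowerRates.wide)
    (hS : S.Rigid) {C l : ℝ} (hC : 0 ≤ C) (hl : 0 < l)
    (hceil : ∀ x : EuclideanSpace ℝ (Fin 3),
      ‖burgersVortexSwirl (l * TowerRates.wide.A 1) 1
          (C * TowerRates.wide.N 2 ^ (TowerRates.wide.β - 2)) x‖ ≤ S.c₂ * TowerRates.wide.Y 2)
    {x₀ : EuclideanSpace ℝ (Fin 3)} (hx0 : x₀ 0 = 0) (hx1 : x₀ 1 = 0)
    (haxis : S.c₁ * TowerRates.wide.A 2 ≤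
      ‖fderiv ℝ (burgersVortexSwirl (l * TowerRates.wide.A 1) 1
        (C * TowerRates.wide.N 2 ^ (TowerRates.wide.β - 2))) x₀‖) :
    13.65 < C * l ∧ C * Real.sqrt l < 24.43 ∧ 0.31 < l ∧ C < 43.8 := by
  have hcap := palasekTowerBreakdown_burgers_ceiling_cap_one S hS hC hl hceil
  have hpin := palasekTowerBreakdown_burgers_axisFloor_pins_one S hS hC hl hx0 hx1 haxis
  have hs : 0 ≤ Real.sqrt l := Real.sqrt_nonneg _
  have hsq : Real.sqrt l ^ 2 = l := Real.sq_sqrt hl.le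
  have hP : 0 ≤ C * Real.sqrt l := mul_nonneg hC hs
  have hid : C * l = Real.sqrt l * (C * Real.sqrt l) := by
    rw [show C * l = C * (Real.sqrt l ^ 2) by rw [hsq]]; ring
  refine ⟨by linarith, hcap, ?_, ?_⟩
  · have h1 : 0.5589 < Real.sqrt l := by
      by_contra h
      push Not at h
      have := mul_le_mul h hcap.le hP (by norm_num)
      nlinarith
    nlinarith
  · have h2 : C * (C * l) = (C * Real.sqrt l) ^ 2 := by
      rw [mul_pow, hsq]; ring
    have h3 : (C * Real.sqrt l) ^ 2 < 24.43 ^ 2 := pow_lt_pow_left₀ hcap hP two_ne_zero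
    nlinarith

/-- **λ-floor at level `1 → 2`, FULL-FIELD READING (sharp form)**: no overshoot of `S.c₂ · Y₂` and
the strain floor `S.c₁ · A₂` met SOMEWHERE on `U_s + v` ⇒ `4.067 < λ(1 + 0.2979·C)` and
**`0.27 < λ`**. -/
theorem palasekTowerBreakdown_burgers_lambda_floor_one_sharp (S : Schedule TowerRates.wide)
    (hS : S.Rigid) {C l : ℝ} (hC : 0 ≤ C) (hl : 0 < l)
    (hceil : ∀ x : EuclideanSpace ℝ (Fin 3),
      ‖burgersVortexSwirl (l * TowerRates.wide.A 1) 1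
          (C * TowerRates.wide.N 2 ^ (TowerRates.wide.β - 2)) x‖ ≤ S.c₂ * TowerRates.wide.Y 2)
    (hstrain : ∃ x : EuclideanSpace ℝ (Fin 3), S.c₁ * TowerRates.wide.A 2 ≤
      ‖fderiv ℝ (burgersVortex (l * TowerRates.wide.A 1) 1
        (C * TowerRates.wide.N 2 ^ (TowerRates.wide.β - 2))) x‖) :
    4.067 < l * (1 + 0.2979 * C) ∧ 0.27 < l := by
  have hcap := palasekTowerBreakdown_burgers_ceiling_cap_one S hS hC hl hceil
  have h1 : 4.067 < l * (1 + 0.2979 * C) := by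
    by_contra h
    push Not at h
    obtain ⟨x, hx⟩ := hstrain
    exact absurd hx (not_le.2
      (palasekTowerBreakdown_burgers_strainFloor_missed_one_sharp S hS hC hl h x))
  refine ⟨h1, ?_⟩
  have hs : 0 ≤ Real.sqrt l := Real.sqrt_nonneg _
  have hsq : Real.sqrt l ^ 2 = l := Real.sq_sqrt hl.le
  have hP : 0 ≤ C * Real.sqrt l := mul_nonneg hC hs
  have h2 : l * C ≤ 24.43 * Real.sqrt l := by
    rw [show l * C = Real.sqrt l * (C * Real.sqrt l) by
      rw [show l * C = Real.sqrt l ^ 2 * C by rw [hsq]]; ring]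
    nlinarith [mul_le_mul_of_nonneg_left hcap.le hs]
  by_contra h
  push Not at h
  have h3 : Real.sqrt l ≤ 0.51962 := by
    rw [Real.sqrt_le_left (by norm_num)]
    linarith
  nlinarith

/-- **THE LEVEL-`1 → 2` BURGERS POLYTOPE, certified**: a level-2 Burgers child core of circulation
`C · N₂^{β−2}` in the host strain `λ · A₁` at `ν = 1` that meets the velocity floor `S.c₁ · Y₂` by its
own swirl, does not overshoot `S.c₂ · Y₂` anywhere, and meets the strain floor `S.c₁ · A₂` by its own
gradient at an axis point, has `13.09 < C√λ < 24.43`, `13.65 < Cλ`, `0.31 < λ`, `C < 43.8`. -/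
theorem palasekTowerBreakdown_burgers_polytope_one (S : Schedule TowerRates.wide) (hS : S.Rigid)
    {C l : ℝ} (hC : 0 ≤ C) (hl : 0 < l)
    (hfloor : ∃ x : EuclideanSpace ℝ (Fin 3), S.c₁ * TowerRates.wide.Y 2 ≤
      ‖burgersVortexSwirl (l * TowerRates.wide.A 1) 1
          (C * TowerRates.wide.N 2 ^ (TowerRates.wide.β - 2)) x‖)
    (hceil : ∀ x : EuclideanSpace ℝ (Fin 3),
      ‖burgersVortexSwirl (l * TowerRates.wide.A 1) 1
          (C * TowerRates.wide.N 2 ^ (TowerRates.wide.β - 2)) x‖ ≤ S.c₂ * TowerRates.wide.Y 2)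
    {x₀ : EuclideanSpace ℝ (Fin 3)} (hx0 : x₀ 0 = 0) (hx1 : x₀ 1 = 0)
    (haxis : S.c₁ * TowerRates.wide.A 2 ≤
      ‖fderiv ℝ (burgersVortexSwirl (l * TowerRates.wide.A 1) 1
        (C * TowerRates.wide.N 2 ^ (TowerRates.wide.β - 2))) x₀‖) :
    (13.09 < C * Real.sqrt l ∧ C * Real.sqrt l < 24.43) ∧ 13.65 < C * l ∧ 0.31 < l ∧ C < 43.8 := by
  obtain ⟨h1, -, h3, h4⟩ :=
    palasekTowerBreakdown_burgers_lambda_floor_axis_one S hS hC hl hceil hx0 hx1 haxis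
  exact ⟨palasekTowerBreakdown_burgers_band_one S hS hC hl hfloor hceil, h1, h3, h4⟩

end Summit.NavierStokesRegularity.FluidComputer.PalasekTowerClayBridge
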